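import Literature.Computability.MetaComplexity.DepthFregeGaussianEliminationChain
import Literature.Computability.MetaComplexity.GaussianWidthDepthFregeUpperBound
import HarnessLib

/-!
# Gaussian elimination inside bounded-depth Frege: subexponential refutations of linear systems

**Theorem** (`depthFrege_gaussianElimination`; the folklore divide-and-conquer upper bound that
matches in shape the `2^{n^{Ω(1/d)}}` lower bounds of Håstad (grids, J. ACM 2021) and
Galesi–Itsykson–Riazanov–Sofronova (APAL 2023) for Tseitin formulas, here for ARBITRARY linear
systems over `𝔽₂`). For all `a ≥ 1` and `D`, every UNSATISFIABLE system `E : Fin m → LinEqMod 2 n`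
of `ℓ`-sparse equations in `n ≤ a^D` variables has a `textbookFrege` proof of the negated parity CNF
`¬ ofCNF (sumEncoding 1 E)` of alternation depth `≤ 2D + 19` and size

  `≤ ((m + 2) · 2^{(D+1)(2a+3) + ℓ})^{110}`,

i.e. `poly(m, 2^ℓ) · 2^{O(D a)}`; with `a ≈ n^{1/D}` this is `2^{O(D n^{1/D})}` at depth `2D + 19`, so
at depth `d` every such system is refutable in size `2^{Õ(n^{2/(d - 19)})}` (`depthFrege_gaussianElimination'`
records the form with the number `n` of variables and the radix `a` only).

Consequently the size lower bounds `2^{n^{ε}}` of the bounded-depth Frege cruxes for XOR-CNFs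
(`ExpansionForcesDepthFregeSize`, `LinearGeneratorDepthFregeHard`, `LinearGeneratorModPFregeHard`
of route PneNP/ExpanderLinearGenerators; `GaussianWidthDepthFregeLB`, `ExpandingXorDepthFregeLB`
of route PneNP/MatroidTseitin) can only hold with `ε = ε(d) = O(1/d)`: the exponent must decay with
the depth (Summits corollaries in the routes' Theorems files).

Proof: `HierarchicalParity*.lean` (hierarchical parity formulas and their combination sequents)
and `DepthFregeGaussianEliminationChain.lean` (rows, the chain along a dual certificate) give a
bounded derivation `BD (2D+18) B Λ (¬F)`; this file bounds the budgets (`hsz_le_two_pow`,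
`combLines_le`) and turns `Λ · B` into the displayed monomial (`GaussFrege.xc/xm/xa/xp`).

References: J. Håstad, *On small-depth Frege proofs for Tseitin for grids*, J. ACM 68 (2021), §1
(discussion of the matching upper bound); N. Galesi, D. Itsykson, A. Riazanov, A. Sofronova,
*Bounded-depth Frege complexity of Tseitin formulas for all graphs*, APAL 174 (2023), Thm. 1
(upper bound `2^{tw(G)^{O(1/d)}} poly` for Tseitin formulas) and §4. The general-linear-system form
is folklore.
-/

namespace Literature.Computability.MetaComplexity

open Complexity Complexity.PropForm TextbookFrege KrajicekRamsey Finset GaussFrege Complexity.Stockmeyer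

namespace HierParity

/-! ### Closed forms of the recursive budgets -/

/-- **Size budget, closed form**: `hsz a j ≤ 2^{(j+1)(2a+3)}`. [folklore] -/
theorem hsz_le_two_pow (a j : ℕ) : hsz a j ≤ 2 ^ ((j + 1) * (2 * a + 3)) := by
  induction j with
  | zero =>
    show 2 ≤ 2 ^ ((0 + 1) * (2 * a + 3))
    calc 2 = 2 ^ 1 := by norm_num
      _ ≤ _ := Nat.pow_le_pow_right (by norm_num) (by nlinarith)
  | succ j ih =>
    show 2 ^ a * (a * (hsz a j + 1) + 2) + 1 ≤ 2 ^ ((j + 1 + 1) * (2 * a + 3))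
    set A := 2 ^ a with hA
    set H := 2 ^ ((j + 1) * (2 * a + 3)) with hH
    have hA1 : 1 ≤ A := Nat.one_le_two_pow
    have haA : a ≤ A := (Nat.lt_two_pow_self (n := a)).le
    have hH2 : 2 ≤ H := by
      calc 2 = 2 ^ 1 := by norm_num
        _ ≤ H := Nat.pow_le_pow_right (by norm_num) (by nlinarith)
    have hpow : 2 ^ ((j + 1 + 1) * (2 * a + 3)) = H * (A * A * 8) := by
      rw [hH, hA, show (j + 1 + 1) * (2 * a + 3) = (j + 1) * (2 * a + 3) + (a + a + 3) by ring,
        pow_add, pow_add, pow_add]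
      norm_num
    rw [hpow]
    have p1 : a * (hsz a j + 1) ≤ A * (H + 1) := Nat.mul_le_mul haA (by omega)
    have p2 : A * (a * (hsz a j + 1) + 2) ≤ A * (A * (H + 1) + 2) := Nat.mul_le_mul_left _ (by omega)
    have p3 : A * (A * (H + 1) + 2) + 1 ≤ H * (A * A * 8) := by nlinarith
    omega

/-- `4a + 1 ≤ 2^{a+2}`. [folklore] -/
theorem four_mul_succ_le_two_pow (a : ℕ) : 4 * a + 1 ≤ 2 ^ (a + 2) := by
  have h : a + 1 ≤ 2 ^ a := Nat.lt_two_pow_self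
  have e : 2 ^ (a + 2) = 2 ^ a * 4 := by rw [pow_add]; norm_num
  rw [e]; omega

/-- **Line budget, closed form**: `combLines a j ≤ M(a) · (4a+1)^j` with
`M(a) = skelPS a + combLines a 0 + (4a+1) c₀(a)`. [folklore] -/
theorem combLines_le (a j : ℕ) : combLines a j ≤
    (skelPS a + combLines a 0 + (4 * a + 1) * (9 + 50 * (4 * a + 4 + 1) ^ 2 + 2)) * (4 * a + 1) ^ j := by
  induction j with
  | zero => rw [pow_zero, mul_one]; omega
  | succ j ih =>
    show skelPS a + 4 * a * (combLines a j + 9 + 50 * (4 * a + 4 + 1) ^ 2 + 2) ≤ _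
    set c₀ := 9 + 50 * (4 * a + 4 + 1) ^ 2 + 2 with hc₀
    set M := skelPS a + combLines a 0 + (4 * a + 1) * c₀ with hM
    have hq1 : 1 ≤ (4 * a + 1) ^ j := Nat.one_le_pow _ _ (by omega)
    have e1 : skelPS a + 4 * a * (combLines a j + 9 + 50 * (4 * a + 4 + 1) ^ 2 + 2) =
        skelPS a + 4 * a * c₀ + 4 * a * combLines a j := by rw [hc₀]; ring
    rw [e1, pow_succ]
    have h1 : skelPS a + 4 * a * c₀ ≤ M * (4 * a + 1) ^ j :=
      calc skelPS a + 4 * a * c₀ ≤ M := by rw [hM]; nlinarith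
        _ = M * 1 := (mul_one _).symm
        _ ≤ M * (4 * a + 1) ^ j := Nat.mul_le_mul_left _ hq1
    have h2 : 4 * a * combLines a j ≤ 4 * a * (M * (4 * a + 1) ^ j) := Nat.mul_le_mul_left _ ih
    nlinarith

end HierParity

open HierParity

/-! ### The main theorem -/

section Main

variable {m n : ℕ}

/-- **Bounded-depth Frege does Gaussian elimination in subexponential size (folklore
divide-and-conquer upper bound).** For `a ≥ 1` and `D`, every unsatisfiable system `E` over `𝔽₂`
of `ℓ`-sparse equations in `n ≤ a^D` variables has a `textbookFrege` proof of
`¬ ofCNF (sumEncoding 1 E)` of alternation depth `≤ 2D + 19` and size at most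
`((m + 2) · 2^{(D+1)(2a+3) + ℓ})^{110}`. [cite: GalesiEtAl2023, Thm. 1 (upper bound) and §4] -/
theorem depthFrege_gaussianElimination (a D ℓ : ℕ) (ha : 1 ≤ a) (E : Fin m → LinEqMod 2 n)
    (hE : ∀ e, (E e).supp.card ≤ ℓ) (hn : n ≤ a ^ D) (hunsat : ¬ SystemSat E univ) :
    ∃ π : List (PropForm ℕ),
      textbookFrege.IsDepthProofOf (2 * D + 19) π (neg (PropForm.ofCNF (sumEncoding 1 E))) ∧
      proofSize π ≤ ((m + 2) * 2 ^ ((D + 1) * (2 * a + 3) + ℓ)) ^ 110 := by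
  have ha0 : 0 < a := ha
  -- parameters
  set SF := (PropForm.ofCNF (sumEncoding 1 E)).size with hSF
  set P := hsz a D + 2 ^ ℓ * (3 * ℓ + 2) + 1 with hP
  set r := 2 ^ ℓ * (3 * ℓ + 4) with hr
  set B := combB a D + 40 * (P + r + ℓ) + 24 * SF + 24 * P + 1000 with hB
  have hSFle : SF ≤ m * (2 ^ ℓ * (3 * ℓ + 2)) + 1 := size_ofCNF_sumEncoding_le E hE
  have hPh : hsz a D ≤ P := by omega
  have hPℓ : 2 ^ ℓ * (3 * ℓ + 2) + 1 ≤ P := by omega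
  have hBc : combB a D ≤ B := by omega
  -- the rows, the chain, the refutation
  have hrow := rowHpS E ha0 (Dl := D) (D := 2 * D + 18) (B := B) hn hE hPℓ hPh (by omega) (by omega)
  have fin := refuteHpS E ha0 hPh (D := 2 * D + 18) le_rfl hBc (by omega) (by omega) hrow hunsat
  obtain ⟨π, hπ, hsize⟩ := fin.exists_isDepthProofOf
  refine ⟨π, hπ, hsize.trans ?_⟩
  -- numerics: everything is `≤ X^k`
  set X := (m + 2) * 2 ^ ((D + 1) * (2 * a + 3) + ℓ) with hX
  have hK : 2 * a + 3 ≤ (D + 1) * (2 * a + 3) := Nat.le_mul_of_pos_left _ (by omega)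
  have hpos : 1 ≤ 2 ^ ((D + 1) * (2 * a + 3) + ℓ) := Nat.one_le_two_pow
  have hX2 : 2 ≤ X := by
    calc 2 ≤ (m + 2) * 1 := by omega
      _ ≤ X := Nat.mul_le_mul_left _ hpos
  have hY : 2 ^ ((D + 1) * (2 * a + 3)) ≤ X ^ 1 := by
    rw [pow_one]
    calc 2 ^ ((D + 1) * (2 * a + 3)) ≤ 2 ^ ((D + 1) * (2 * a + 3) + ℓ) :=
          Nat.pow_le_pow_right (by norm_num) (Nat.le_add_right _ _)
      _ ≤ X := Nat.le_mul_of_pos_left _ (by omega)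
  have h2a : 2 ^ a ≤ X ^ 1 := (Nat.pow_le_pow_right (by norm_num) (by omega)).trans hY
  have haX : a ≤ X ^ 1 := ((Nat.lt_two_pow_self (n := a)).le).trans h2a
  have h26a : 2 ^ (6 * a) ≤ X ^ 3 := by
    refine le_trans ?_ (xp hY 3)
    rw [← pow_mul]
    exact Nat.pow_le_pow_right (by norm_num) (by omega)
  have h2ℓ : 2 ^ ℓ ≤ X ^ 1 := by
    rw [pow_one]
    calc 2 ^ ℓ ≤ 2 ^ ((D + 1) * (2 * a + 3) + ℓ) := Nat.pow_le_pow_right (by norm_num) (Nat.le_add_left _ _)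
      _ ≤ X := Nat.le_mul_of_pos_left _ (by omega)
  have hℓX : ℓ ≤ X ^ 1 := ((Nat.lt_two_pow_self (n := ℓ)).le).trans h2ℓ
  have hmX : m ≤ X ^ 1 := by
    rw [pow_one]
    calc m ≤ (m + 2) * 1 := by omega
      _ ≤ X := Nat.mul_le_mul_left _ hpos
  have hhsz : hsz a D ≤ X ^ 1 := (hsz_le_two_pow a D).trans hY
  have hpowD : (4 * a + 1) ^ D ≤ X ^ 1 := by
    refine le_trans ?_ hY
    calc (4 * a + 1) ^ D ≤ (2 ^ (a + 2)) ^ D := Nat.pow_le_pow_left (four_mul_succ_le_two_pow a) D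
      _ = 2 ^ ((a + 2) * D) := by rw [← pow_mul]
      _ ≤ 2 ^ ((D + 1) * (2 * a + 3)) := Nat.pow_le_pow_right (by norm_num) (by nlinarith)
  -- constants
  have c1 : 1 ≤ X ^ 0 := by rw [pow_zero]
  have c2 : 2 ≤ X ^ 1 := xc hX2 (by norm_num)
  have c3 : 3 ≤ X ^ 2 := xc hX2 (by norm_num)
  have c4 : 4 ≤ X ^ 2 := xc hX2 (by norm_num)
  have c6 : 6 ≤ X ^ 3 := xc hX2 (by norm_num)
  have c8 : 8 ≤ X ^ 3 := xc hX2 (by norm_num)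
  have c9 : 9 ≤ X ^ 4 := xc hX2 (by norm_num)
  have c11 : 11 ≤ X ^ 4 := xc hX2 (by norm_num)
  have c24 : 24 ≤ X ^ 5 := xc hX2 (by norm_num)
  have c40 : 40 ≤ X ^ 6 := xc hX2 (by norm_num)
  have c50 : 50 ≤ X ^ 6 := xc hX2 (by norm_num)
  have c64 : 64 ≤ X ^ 6 := xc hX2 (by norm_num)
  have c100 : 100 ≤ X ^ 7 := xc hX2 (by norm_num)
  have c130 : 130 ≤ X ^ 8 := xc hX2 (by norm_num)
  have c200 : 200 ≤ X ^ 8 := xc hX2 (by norm_num)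
  have c450 : 450 ≤ X ^ 9 := xc hX2 (by norm_num)
  have c458 : 458 ≤ X ^ 9 := xc hX2 (by norm_num)
  have c802 : 802 ≤ X ^ 10 := xc hX2 (by norm_num)
  have c1000 : 1000 ≤ X ^ 10 := xc hX2 (by norm_num)
  have c3750 : 3750 ≤ X ^ 12 := xc hX2 (by norm_num)
  have c6400 : 6400 ≤ X ^ 13 := xc hX2 (by norm_num)
  have cL0 : combLines a 0 ≤ X ^ 18 := by
    have : combLines a 0 = 199304 := by rfl
    rw [this]; exact xc hX2 (by norm_num)
  -- the skeleton budgets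
  have b4a : 4 * a ≤ X ^ 3 := xm c4 haX
  have bskelS : skelS a ≤ X ^ 8 := by
    unfold skelS
    exact xa hX2 (xm b4a c11) (xm c3 (xa hX2 (xm h2a (xa hX2 (xm c2 haX) c2)) c3))
  have bskelL : skelLines a ≤ X ^ 30 := by
    unfold skelLines
    have t1 : skelS a * (100 * (6 * a + 8) ^ 2) ≤ X ^ 25 :=
      xm bskelS (xm c100 (xp (xa hX2 (xm c6 haX) c8) 2))
    have t2 : 50 * (6 * a + (4 * a + 3) + 3) ^ 2 ≤ X ^ 18 :=
      xm c50 (xp (xa hX2 (xa hX2 (xm c6 haX) (xa hX2 b4a c3)) c3) 2)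
    exact xm h26a (xa hX2 (xa hX2 t1 t2) c2)
  have bskelPS : skelPS a ≤ X ^ 46 := by
    unfold skelPS
    exact xm bskelL (xa hX2 (xm c40 (xa hX2 bskelS (xm c6 haX))) c200)
  -- `combLines`, `combB`
  have bc₀ : 9 + 50 * (4 * a + 4 + 1) ^ 2 + 2 ≤ X ^ 18 :=
    xa hX2 (xa hX2 c9 (xm c50 (xp (xa hX2 (xa hX2 b4a c4) c1) 2))) c2
  have b4a1 : 4 * a + 1 ≤ X ^ 4 := xa hX2 b4a c1
  have bcomb : combLines a D ≤ X ^ 49 :=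
    (combLines_le a D).trans (xm (xa hX2 (xa hX2 bskelPS cL0) (xm b4a1 bc₀)) hpowD)
  have bcombB : combB a D ≤ X ^ 49 := by
    unfold combB
    exact xa hX2 (xa hX2 (xm bskelPS hhsz) (xm (xa hX2 (xm c64 haX) c64) (xa hX2 hhsz c4))) c1000
  -- `P`, `SF`, `r`, `B`
  have b3ℓ2 : 3 * ℓ + 2 ≤ X ^ 4 := xa hX2 (xm c3 hℓX) c2
  have bP : P ≤ X ^ 7 := xa hX2 (xa hX2 hhsz (xm h2ℓ b3ℓ2)) c1
  have bSF : SF ≤ X ^ 7 := hSFle.trans (xa hX2 (xm hmX (xm h2ℓ b3ℓ2)) c1)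
  have br : r ≤ X ^ 5 := xm h2ℓ (xa hX2 (xm c3 hℓX) c4)
  have bB : B ≤ X ^ 53 :=
    xa hX2 (xa hX2 (xa hX2 (xa hX2 bcombB (xm c40 (xa hX2 (xa hX2 bP br) hℓX))) (xm c24 bSF))
      (xm c24 bP)) c1000
  -- `rowLines`, `endLines`, `stepHLines`, `totHLines`
  have bRw : rowLines ℓ P SF ≤ X ^ 29 := by
    unfold rowLines
    have t1 : (P + 1 + 2 ^ ℓ * (3 * ℓ + 4)) * (100 * (ℓ + 8) ^ 2) ≤ X ^ 24 :=
      xm (xa hX2 (xa hX2 bP c1) br) (xm c100 (xp (xa hX2 hℓX c8) 2))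
    have t2 : 50 * (ℓ + 2 ^ ℓ + 4) ^ 2 ≤ X ^ 12 := xm c50 (xp (xa hX2 (xa hX2 hℓX h2ℓ) c4) 2)
    have t3 : 50 * (2 ^ ℓ + 4) ^ 2 ≤ X ^ 12 := xm c50 (xp (xa hX2 h2ℓ c4) 2)
    have t4 : 2 ^ ℓ * (130 * (SF + 2) + 50 * (2 ^ ℓ + 4) ^ 2 + 458) ≤ X ^ 19 :=
      xm h2ℓ (xa hX2 (xa hX2 (xm c130 (xa hX2 bSF c2)) t3) c458)
    exact xa hX2 (xa hX2 (xm h2ℓ (xa hX2 (xa hX2 t1 t2) c2)) t3) t4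
  have bEnd : endLines (hsz a D) ≤ X ^ 16 := by
    have : endLines (hsz a D) ≤ (hsz a D + 2) * 6400 + 802 := by unfold endLines; norm_num
    exact this.trans (xa hX2 (xm (xa hX2 hhsz c2) c6400) c802)
  have bStep : stepHLines (rowLines ℓ P SF) (combLines a D) ≤ X ^ 52 := by
    unfold stepHLines
    exact xa hX2 (xa hX2 (xa hX2 bRw bcomb) (show 3 * 1250 ≤ X ^ 12 from c3750)) c4
  have bTot : totHLines m (rowLines ℓ P SF) (combLines a D) (endLines (hsz a D)) ≤ X ^ 57 := by
    unfold totHLines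
    exact xa hX2 (xa hX2 (xa hX2 (xa hX2 (xa hX2 bEnd c450) (xm hmX bStep)) (xa hX2 bEnd c450)) c2) c8
  exact xm bTot bB

/-- **The same, displayed with the number of variables**: if `n ≤ a^D` then the size is at most
`((m + 2) · 2^{(D+1)(2a+3) + ℓ})^{110}` at depth `2D + 19`; taking the least such `a` (about
`n^{1/D}`) gives `2^{O(D n^{1/D} + ℓ + log m)}`. [cite: GalesiEtAl2023, Thm. 1 (upper bound) and §4] -/
theorem depthFrege_gaussianElimination' (D ℓ : ℕ) (E : Fin m → LinEqMod 2 n)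
    (hE : ∀ e, (E e).supp.card ≤ ℓ) (hunsat : ¬ SystemSat E univ) (a : ℕ) (ha : 1 ≤ a) (hn : n ≤ a ^ D) :
    ∃ π : List (PropForm ℕ),
      textbookFrege.IsDepthProofOf (2 * D + 19) π (neg (PropForm.ofCNF (sumEncoding 1 E))) ∧
      proofSize π ≤ (m + 2) ^ 110 * 2 ^ (110 * ((D + 1) * (2 * a + 3) + ℓ)) := by
  obtain ⟨π, hπ, hsize⟩ := depthFrege_gaussianElimination a D ℓ ha E hE hn hunsat
  refine ⟨π, hπ, hsize.trans (le_of_eq ?_)⟩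
  rw [mul_pow, ← pow_mul, Nat.mul_comm _ 110]

end Main

end Literature.Computability.MetaComplexity
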